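import Mathlib.Analysis.SpecialFunctions.Integrals.Basic
import Mathlib.Analysis.SpecialFunctions.Trigonometric.DerivHyp
import Mathlib.MeasureTheory.Integral.IntervalIntegral.FundThmCalculus
import Mathlib.Analysis.Calculus.Deriv.MeanValue
import HarnessLib

/-!
# The Abresch–Gromoll comparison profile for the hyperbolic model (`Ric ≥ -(m-1)`)

The radial comparison function of Cheeger–Colding 1996, proof of Prop. 6.2 ("as in [AG], given
`x`, we can construct … a function `G` on `B_{1+ψ}(x) ∖ x` such that … `ΔG = ` const for the
model"), i.e. the solution of `G'' + (m-1) coth(r) G' = b` on `(0, ∞)` with `G(R) = 0` that is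
decreasing on `(0, R₁]` (`R ≤ R₁`): with `φ = sinh^{m-1}` and `Φ(r) = ∫₀ʳ φ`,
`G'(r) = b (Φ(r) - Φ(R₁))/φ(r)`, `G(r) = -∫ᵣᴿ G'`. Zhu 1997, Remark after Thm. 4.15 ("an estimate
holds for general lower bounds on Ricci curvature"). We PROVE (explicit formulas, no definitions):
the derivative of `Φ`, positivity and strict monotonicity of `Φ`, the derivative `G''` of `G'` and
the hyperbolic model identity `G'' + (m-1) coth G' = b`, `G' < 0` on `(0, R₁)`, the derivative of
`G` (FTC) with `G(R) = 0`, and strict antitonicity of `G` on `[c, R]` (`0 < c`, `R ≤ R₁`).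
No definitions, no named facts (D-0026). Groundwork for `CheegerColding1997_sphereStability`
(feeds `abreschGromoll_lemma_hyperbolic`).

## References

* J. Cheeger, T. H. Colding, Ann. of Math. 144 (1996) 189–237, proof of Prop. 6.2. [CheegerColding1996]
* S.-H. Zhu, in *Comparison Geometry*, MSRI Publ. 30 (1997) 221–262, Lemma 4.14, Remark after
  Thm. 4.15. [Zhu1997ComparisonRicci]
-/

noncomputable section

open Set MeasureTheory intervalIntegral

namespace Literature.Geometry.Riemannian

/-! ### §1 `φ = sinh^{m-1}` and its primitive `Φ` -/

/-- `φ = sinh^{k}` has derivative `k sinh^{k-1} cosh`. [folklore] -/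
theorem hasDerivAt_sinh_pow (k : ℕ) (r : ℝ) :
    HasDerivAt (fun t : ℝ ↦ Real.sinh t ^ k) ((k : ℝ) * Real.sinh r ^ (k - 1) * Real.cosh r) r :=
  (Real.hasDerivAt_sinh r).fun_pow k

/-- On `(0, ∞)`: `(sinh^k)' = k coth · sinh^k`. [folklore] -/
theorem deriv_sinh_pow_eq_coth_mul {k : ℕ} {r : ℝ} (hr : 0 < r) :
    (k : ℝ) * Real.sinh r ^ (k - 1) * Real.cosh r =
      (k : ℝ) * (Real.cosh r / Real.sinh r) * Real.sinh r ^ k := by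
  have hs : Real.sinh r ≠ 0 := (Real.sinh_pos_iff.2 hr).ne'
  rcases Nat.eq_zero_or_pos k with h0 | hk
  · subst h0; simp
  · have h1 : Real.sinh r ^ k = Real.sinh r ^ (k - 1) * Real.sinh r := by
      rw [← pow_succ, Nat.sub_add_cancel hk]
    rw [h1]
    field_simp

/-- The primitive `Φ(r) = ∫₀ʳ sinh^k` has derivative `sinh^k r`. [folklore] -/
theorem hasDerivAt_primitive_sinh_pow (k : ℕ) (r : ℝ) :
    HasDerivAt (fun u : ℝ ↦ ∫ t in (0 : ℝ)..u, Real.sinh t ^ k) (Real.sinh r ^ k) r := by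
  have hcont : Continuous fun t : ℝ ↦ Real.sinh t ^ k := Real.continuous_sinh.pow k
  exact intervalIntegral.integral_hasDerivAt_right (hcont.intervalIntegrable _ _)
    (hcont.stronglyMeasurableAtFilter _ _) hcont.continuousAt

/-- `Φ` is strictly increasing on `[0, ∞)`. [folklore] -/
theorem strictMonoOn_primitive_sinh_pow (k : ℕ) :
    StrictMonoOn (fun u : ℝ ↦ ∫ t in (0 : ℝ)..u, Real.sinh t ^ k) (Ici 0) := by
  refine strictMonoOn_of_deriv_pos (convex_Ici 0)
    (fun r _ ↦ (hasDerivAt_primitive_sinh_pow k r).continuousAt.continuousWithinAt) ?_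
  intro r hr
  rw [interior_Ici] at hr
  rw [(hasDerivAt_primitive_sinh_pow k r).deriv]
  exact pow_pos (Real.sinh_pos_iff.2 hr) k

/-- `Φ(r) > 0` for `r > 0`. [folklore] -/
theorem primitive_sinh_pow_pos (k : ℕ) {r : ℝ} (hr : 0 < r) :
    0 < ∫ t in (0 : ℝ)..r, Real.sinh t ^ k := by
  have h := strictMonoOn_primitive_sinh_pow k self_mem_Ici (hr.le : r ∈ Ici (0:ℝ)) hr
  simpa using h

/-! ### §2 The derivative profile `G'(r) = b (Φ(r) - Φ(R₁))/φ(r)` and the model identity -/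

/-- **`G' < 0` on `(0, R₁)`**. [cite: CheegerColding1996, Prop. 6.2 (proof)] -/
theorem agProfileHyp_deriv_neg (k : ℕ) {b R₁ r : ℝ} (hb : 0 < b) (hr : 0 < r) (hrR : r < R₁) :
    b * ((∫ t in (0 : ℝ)..r, Real.sinh t ^ k) - ∫ t in (0 : ℝ)..R₁, Real.sinh t ^ k) /
      Real.sinh r ^ k < 0 := by
  have h1 : (∫ t in (0 : ℝ)..r, Real.sinh t ^ k) < ∫ t in (0 : ℝ)..R₁, Real.sinh t ^ k :=
    strictMonoOn_primitive_sinh_pow k (hr.le : r ∈ Ici (0:ℝ)) ((hr.trans hrR).le : R₁ ∈ Ici (0:ℝ)) hrR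
  have h2 : 0 < Real.sinh r ^ k := pow_pos (Real.sinh_pos_iff.2 hr) k
  exact div_neg_of_neg_of_pos (mul_neg_of_pos_of_neg hb (by linarith)) h2

/-- **The second derivative**: for `r > 0`,
`(G')'(r) = b (1 - (Φ(r) - Φ(R₁)) · k coth(r) / φ(r))` where `φ = sinh^k`.
[cite: CheegerColding1996, Prop. 6.2 (proof)] -/
theorem hasDerivAt_agProfileHyp_deriv (k : ℕ) (b R₁ : ℝ) {r : ℝ} (hr : 0 < r) :
    HasDerivAt (fun s : ℝ ↦ b * ((∫ t in (0 : ℝ)..s, Real.sinh t ^ k) -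
        ∫ t in (0 : ℝ)..R₁, Real.sinh t ^ k) / Real.sinh s ^ k)
      (b * (1 - ((∫ t in (0 : ℝ)..r, Real.sinh t ^ k) - ∫ t in (0 : ℝ)..R₁, Real.sinh t ^ k) *
        ((k : ℝ) * (Real.cosh r / Real.sinh r)) / Real.sinh r ^ k)) r := by
  have hs : Real.sinh r ≠ 0 := (Real.sinh_pos_iff.2 hr).ne'
  have hφ : Real.sinh r ^ k ≠ 0 := pow_ne_zero k hs
  have hnum : HasDerivAt (fun s : ℝ ↦ b * ((∫ t in (0 : ℝ)..s, Real.sinh t ^ k) -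
      ∫ t in (0 : ℝ)..R₁, Real.sinh t ^ k)) (b * Real.sinh r ^ k) r := by
    simpa using ((hasDerivAt_primitive_sinh_pow k r).sub_const _).const_mul b
  have h := hnum.div (hasDerivAt_sinh_pow k r) hφ
  refine (h.congr_deriv ?_)
  rw [deriv_sinh_pow_eq_coth_mul hr]
  field_simp

/-- **The hyperbolic model identity** `G'' + k coth(r) G' = b` (`k = m - 1`;
`Δ_{ℍ}(G ∘ d) = b`), `r > 0`. [cite: CheegerColding1996, Prop. 6.2 (proof)] -/
theorem agProfileHyp_model (k : ℕ) (b R₁ : ℝ) {r : ℝ} (hr : 0 < r) :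
    b * (1 - ((∫ t in (0 : ℝ)..r, Real.sinh t ^ k) - ∫ t in (0 : ℝ)..R₁, Real.sinh t ^ k) *
        ((k : ℝ) * (Real.cosh r / Real.sinh r)) / Real.sinh r ^ k) +
      (k : ℝ) * (Real.cosh r / Real.sinh r) *
        (b * ((∫ t in (0 : ℝ)..r, Real.sinh t ^ k) - ∫ t in (0 : ℝ)..R₁, Real.sinh t ^ k) /
          Real.sinh r ^ k) = b := by
  have hs : Real.sinh r ≠ 0 := (Real.sinh_pos_iff.2 hr).ne'
  have hφ : Real.sinh r ^ k ≠ 0 := pow_ne_zero k hs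
  field_simp
  ring

/-! ### §3 The profile `G(r) = -∫ᵣᴿ G'` -/

/-- `G'` is continuous on `(0, ∞)`. [folklore] -/
theorem continuousOn_agProfileHyp_deriv (k : ℕ) (b R₁ : ℝ) :
    ContinuousOn (fun s : ℝ ↦ b * ((∫ t in (0 : ℝ)..s, Real.sinh t ^ k) -
        ∫ t in (0 : ℝ)..R₁, Real.sinh t ^ k) / Real.sinh s ^ k) (Ioi 0) := fun _ hr ↦
  (hasDerivAt_agProfileHyp_deriv k b R₁ hr).continuousAt.continuousWithinAt

/-- **The profile and its derivative** (FTC): for `0 < r`,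
`G(s) = -∫ₛᴿ G'` (an interval integral) has derivative `G'(r)` at `r`.
[cite: CheegerColding1996, Prop. 6.2 (proof)] -/
theorem hasDerivAt_agProfileHyp (k : ℕ) (b R₁ : ℝ) {R r : ℝ} (hR : 0 < R) (hr : 0 < r) :
    HasDerivAt (fun s : ℝ ↦ -∫ u in s..R, b * ((∫ t in (0 : ℝ)..u, Real.sinh t ^ k) -
        ∫ t in (0 : ℝ)..R₁, Real.sinh t ^ k) / Real.sinh u ^ k)
      (b * ((∫ t in (0 : ℝ)..r, Real.sinh t ^ k) - ∫ t in (0 : ℝ)..R₁, Real.sinh t ^ k) /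
        Real.sinh r ^ k) r := by
  set f := fun u : ℝ ↦ b * ((∫ t in (0 : ℝ)..u, Real.sinh t ^ k) -
    ∫ t in (0 : ℝ)..R₁, Real.sinh t ^ k) / Real.sinh u ^ k with hf
  have hcont := continuousOn_agProfileHyp_deriv k b R₁
  have hint : IntervalIntegrable f volume r R :=
    (hcont.mono (by
      intro u hu
      rcases le_total r R with h | h
      · rw [uIcc_of_le h] at hu; exact hr.trans_le hu.1
      · rw [uIcc_of_ge h] at hu; exact hR.trans_le hu.1)).intervalIntegrable
  have hmeas : StronglyMeasurableAtFilter f (nhds r) volume :=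
    hcont.stronglyMeasurableAtFilter isOpen_Ioi r hr
  have hca : ContinuousAt f r := hcont.continuousAt (Ioi_mem_nhds hr)
  have h := (intervalIntegral.integral_hasDerivAt_left hint hmeas hca).neg
  rw [neg_neg] at h
  exact h

/-- **`G(R) = 0`**. [cite: CheegerColding1996, Prop. 6.2 (proof)] -/
theorem agProfileHyp_apply_self (k : ℕ) (b R₁ R : ℝ) :
    -∫ u in R..R, b * ((∫ t in (0 : ℝ)..u, Real.sinh t ^ k) -
        ∫ t in (0 : ℝ)..R₁, Real.sinh t ^ k) / Real.sinh u ^ k = 0 := by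
  simp

/-- **Strict antitonicity of `G` on `[c, R]`** for `0 < c`, `R ≤ R₁`, `b > 0`.
[cite: CheegerColding1996, Prop. 6.2 (proof)] -/
theorem strictAntiOn_agProfileHyp (k : ℕ) {b R₁ R c : ℝ} (hb : 0 < b) (hc : 0 < c) (hR : 0 < R)
    (hRR₁ : R ≤ R₁) :
    StrictAntiOn (fun s : ℝ ↦ -∫ u in s..R, b * ((∫ t in (0 : ℝ)..u, Real.sinh t ^ k) -
        ∫ t in (0 : ℝ)..R₁, Real.sinh t ^ k) / Real.sinh u ^ k) (Icc c R) := by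
  refine strictAntiOn_of_deriv_neg (convex_Icc c R) ?_ ?_
  · exact fun r hr ↦ (hasDerivAt_agProfileHyp k b R₁ hR (hc.trans_le hr.1)).continuousAt
      |>.continuousWithinAt
  · intro r hr
    rw [interior_Icc] at hr
    rw [(hasDerivAt_agProfileHyp k b R₁ hR (hc.trans hr.1)).deriv]
    exact agProfileHyp_deriv_neg k hb (hc.trans hr.1) (hr.2.trans_le hRR₁)

end Literature.Geometry.Riemannian

end
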